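import Literature.NumberTheory.LFunctions.ZetaGapRecordsRH
import Mathlib.NumberTheory.LSeries.RiemannZeta
import Mathlib.Analysis.SpecialFunctions.Trigonometric.Sinc
import Mathlib.Analysis.SpecialFunctions.Pow.Real
import Mathlib.Analysis.Calculus.ContDiff.Defs
import Mathlib.MeasureTheory.Integral.Bochner.Basic
import HarnessLib

/-!
# Dirichlet-polynomial measures `μ_A` on the critical line and the windows `C_{1,α}`, `C_{2,α}`
# (Aryan 2019, Theorem 5.1 and Corollary 2.2)

Topic `Literature/NumberTheory/LFunctions` (namespace `Literature.NumberTheory.LFunctions`; the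
paper's objects in the sub-namespace `Aryan2019`, shared with Part C of
`AlternativeHypothesisConsequences.lean`, which types the same preprint's Theorem 1.1). STATEMENT
LAYER (D-0014): two CLAIMS of an unrefereed preprint, typed for the cell `landau-siegel` (rung F-S3,
§C harvest row T-088 / P-106; tag E*-ℓ — a printed CEILING for short-resonator zero-spacing
detectors: no probability measure built from a Dirichlet polynomial of length `< T^{1−ε}` makes the
expected value of the pair-window `C_{1,1}` exceed `0.79371`, whereas `> 1` is what a refutation of
the Alternative Hypothesis along these lines would need, §4.1 of the source).
The programme SEARCHES and TYPES; no claim about Landau–Siegel zeros, Theorems 1–2 of arXiv:2211.02515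
or a repaired Margin232 until a kernel theorem says so.

## What the source prints (held text `paper:arxiv-1910.02408`, LaTeX source, 14 chunks, read 2026-08-26)

F. Aryan, *A new approach to gaps between zeta zeros*, arXiv:1910.02408 (2019) [Aryan2019]
(apparently published, retitled, as *On gaps between zeta zeros*, Int. J. Number Theory,
doi:10.1142/S1793042126500223 — NOT read; every locator below is to the arXiv text).

§2 (chunk p0005). "For `a, b > 0`, consider the probability measure
`μ_A((a,b]) := ∫_a^b ω(½+it)|A(½+it)|² / ∫ ω(½+it)|A(½+it)|²` (def_A), where
`A(s) = Σ_{n<T^{1−ε}} a(n) n^{−s}` is a Dirichlet polynomial and `ω` a cut-off weight, centered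
around `T`, with `‖ω‖₁ = 1`." "Definition. Let `α ∈ ℝ⁺` and let `γ` be an imaginary part of a zero
of the zeta function. Define
`C_{1,α}(t) := −α⁻¹ + Σ_γ (sin(½α(γ−t) log T)/(½α(γ−t) log T))²`,
`C_{2,α}(t) := −α⁻¹ + Σ_γ (sin(½α(γ−t) log T)/(½α(γ−t) log T))² · (1 − (α(t−γ) log T/2π)²)⁻¹`."
(defC): `Ĉ₁(v) = (sin πv/πv)²`, `Ĉ₂(v) = (sin πv/πv)² (1 − v²)⁻¹`.

> **Corollary 2.2** (p0005:L61–70). Assume the Riemann hypothesis, then either we have infinitely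
> many zeta zeros of height asymptotic to `T`, that spaced smaller than the half of the average gap,
> i.e. `γ_{n+1} − γ_n < π/log T`, or we have `γ_{n+2} − γ_n < 1.181 · 2π/log T`.

(Proof, §3 p0007:L13–33: Theorem 2.1 gives `∫ C_{2,1} dμ_A = 0.8226…` for a specific `A`, hence a
`t` with `C_{2,1}(t) > 0.8226`; if no normalised gap near `t` is `< ½`, a numerical optimisation
forces "two consecutive gaps of length `x, y` with `x + y < 1.181`".)

> **Theorem 5.1** (§5, p0010:L8–24). Let `A(s)` be a Dirichlet polynomial of length smaller than
> `T^{1−ε}` and `μ_A` defined as (def_A). We have that `E_{C_{1,1},A} = ∫ C_{1,1}(t) dμ_A < 0.79371`.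
> Also, we have `E_{C_{2,1},A} = ∫ C_{2,1}(t) dμ_A < 0.90156`.

"Remark 3. We assumed the Riemann hypothesis in our results." (p0010) — so RH is carried as a
hypothesis of both claims. Proof of Theorem 5.1: §7 (p0013:L69 ff.: Cauchy–Schwarz on the
prime-shift form `(2/log T) Σ_{mp<T} a(m)a(mp)(log p/mp)(1 − log p/log T)` of the numerator and
`max (2/√3)√((1−x³)x) = 0.79370…`).

## Lean rendering / design choices (audit notes for ls-lit-ref)

* Zeros: the tree's index vocabulary (`ZetaZeros.lean`): the positive ordinates are
  `γ_n = zetaOrdinate n` (non-decreasing, with multiplicity); "`Σ_γ`" over ALL non-trivial zeros is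
  the `tsum` over `n` of the terms at `γ_n` and at `−γ_n` (absolutely convergent: the summand is
  `≪ (γ − t)^{−2}`). In the variable `v = α(γ − t) log T/2π` the printed summands are exactly
  `Ĉ₁(v)`, `Ĉ₂(v)` (`Aryan2019.cHat₁/cHat₂`, with Mathlib's `Real.sinc`); `Ĉ₂`'s removable
  singularity at `v = ±1` has the value `0`, which is also Lean's `x/0` — no junk.
* `A(½+it) = Σ_{1≤n≤N} a(n) n^{−½−it}` with REAL coefficients (the proof manipulates `a(m)a(mp)` and
  `|a(m)|²`; real is the weaker reading) and length `N < T^{1−ε}` (`Aryan2019.critLinePoly`).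
* The weight: the print only says "a cut-off weight, centered around `T`, with `‖ω‖₁ = 1`"; the
  proofs use the rapid decay of `ω̂` (p0006:L92). Rendered as the dilate `ω_T(t) = T⁻¹ w(t/T)` of a
  FIXED smooth bump `w ≥ 0` supported in `[1, 2]` with `∫ w = 1` (`Aryan2019.IsBump`,
  `Aryan2019.scaledWeight`; then `‖ω_T‖₁ = 1`, PROVED `integral_scaledWeight`) — the narrowest
  standard class, so the typed claim is implied by any reasonable reading of the print.
* `E_{C,A} = ∫ C dμ_A` is `Aryan2019.expectation C w a N T = (∫ C ω_T |A|²)/(∫ ω_T |A|²)`; for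
  `A ≡ 0` this is the junk `0/0 = 0`, which satisfies both printed upper bounds, so no
  non-degeneracy hypothesis is needed.
* "length smaller than `T^{1−ε}`", "`T` large" (implicit: all estimates of the source are
  asymptotic in `T`): for every `ε > 0`, every bump `w` and every FAMILY `T ↦ (N_T, a_T)` with
  `N_T < T^{1−ε}`, the two strict bounds hold for all sufficiently large `T` (`∀ᶠ T in atTop`) — the
  sequential reading; it is implied by (and by a diagonal argument equivalent to) uniformity in `A`.
* Corollary 2.2's first alternative ("infinitely many zeros of height `∼ T` with
  `γ_{n+1} − γ_n < π/log T`") is rendered by the tree's `ZetaGapLiminfLe (1/2)` (`μ ≤ ½` for the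
  normalised gaps `δ_n = (γ_{n+1} − γ_n) log γ_n/2π`, `ZetaGapRecordsRH.lean`; `log γ_n ∼ log T`);
  the second ("`γ_{n+2} − γ_n < 1.181·2π/log T`", i.e. two consecutive gaps of total normalised
  length `< 1.181`, infinitely often — proof p0007:L33) as: for every `θ > 1.181`, infinitely many
  `n` have `(γ_{n+2} − γ_n) log γ_n/2π ≤ θ`. Both are the robust (non-strict, `θ`-slack) forms the
  tree uses for gap records; each is implied by the printed strict form.
* Numerical constants verbatim: `0.79371`, `0.90156`, `1.181`, `½`.

WHAT THIS IS NOT: not Theorem 2.1 (the mollified-mean asymptotic with `λ_{β₁,β₂} d_r (1 − log n/log T)^η`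
coefficients — a candidate for a later file if §B asks); no claim about AH itself; no claim for
Dirichlet polynomials of length `≥ T`.

## References

* [Aryan2019] F. Aryan, *A new approach to gaps between zeta zeros*, arXiv:1910.02408: §2 (def_A),
  (defC), Cor. 2.2 (chunk p0005); §5 Thm. 5.1, Remark 3 (chunk p0010); proofs §3 (p0007), §7 (p0013).
  UNREFEREED text: `[claim: Aryan2019, status: under-review]`.
* H. L. Montgomery, *The pair correlation of zeros of the zeta function* (1973) — the window
  `(sin/·)²` and `μ`; tree `ZetaGapRecordsRH.lean`. [Montgomery1973]
-/

noncomputable section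

open scoped Real Topology
open Filter MeasureTheory Complex

namespace Literature.NumberTheory.LFunctions

namespace Aryan2019

/-! ### The Fourier pair windows `Ĉ₁`, `Ĉ₂` and the zero-sums `C_{1,α}`, `C_{2,α}` -/

/-- `Ĉ₁(v) = (sin πv/πv)²` (defC). [cite: Aryan2019, §2 (defC)] -/
def cHat₁ (v : ℝ) : ℝ :=
  Real.sinc (π * v) ^ 2

/-- `Ĉ₂(v) = (sin πv/πv)² · (1 − v²)⁻¹` (defC); at `v = ±1` the singularity is removable with value
`0`, which is also the value Lean assigns (`x / 0 = 0`). [cite: Aryan2019, §2 (defC)] -/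
def cHat₂ (v : ℝ) : ℝ :=
  Real.sinc (π * v) ^ 2 / (1 - v ^ 2)

/-- `Ĉ₁ ≥ 0`. [cite: Aryan2019, §2 (defC)] -/
theorem cHat₁_nonneg (v : ℝ) : 0 ≤ cHat₁ v := sq_nonneg _

/-- `Ĉ₁(0) = 1`. [cite: Aryan2019, §2 (defC)] -/
theorem cHat₁_zero : cHat₁ 0 = 1 := by simp [cHat₁]

/-- `Ĉ₂(0) = 1`. [cite: Aryan2019, §2 (defC)] -/
theorem cHat₂_zero : cHat₂ 0 = 1 := by simp [cHat₂]

/-- `Ĉ₂(v) < 0` for `|v| > 1` away from the zeros of `sin πv` — here only the sign of the second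
factor: `(1 − v²)⁻¹ < 0` for `1 < |v|` ("for `x > 1`, we have that `Ĉ₂(x) < 0`", p0007), in the weak
form `Ĉ₂(v) ≤ 0`. [cite: Aryan2019, §3 (proof of Cor. 2.2)] -/
theorem cHat₂_nonpos_of_one_lt_abs {v : ℝ} (hv : 1 < |v|) : cHat₂ v ≤ 0 := by
  unfold cHat₂
  have h1 : 1 - v ^ 2 < 0 := by
    have : 1 < v ^ 2 := by
      have h := sq_lt_sq' (by linarith [abs_nonneg v]) hv
      simpa using h
    linarith
  exact div_nonpos_of_nonneg_of_nonpos (sq_nonneg _) h1.le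

/-- The generic zero-window `−α⁻¹ + Σ_γ K(α(γ − t) log T/2π)`, the sum over ALL ordinates `±γ_n` of
non-trivial zeros of `ζ` (with multiplicity; `γ_n = zetaOrdinate n > 0`), as a `tsum`.
[cite: Aryan2019, §2 (Definition of C_{1,α}, C_{2,α})] -/
def zeroWindow (K : ℝ → ℝ) (α T t : ℝ) : ℝ :=
  -α⁻¹ + ∑' n : ℕ, (K (α * (zetaOrdinate n - t) * Real.log T / (2 * π)) +
    K (α * (-zetaOrdinate n - t) * Real.log T / (2 * π)))

/-- **`C_{1,α}(t) = −α⁻¹ + Σ_γ (sin(½α(γ−t) log T)/(½α(γ−t) log T))²`** (note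
`½α(γ−t) log T = π v` with `v = α(γ−t) log T/2π`, so the summand is `Ĉ₁(v)`).
[cite: Aryan2019, §2 (Definition of C_{1,α})] -/
def windowC₁ (α T t : ℝ) : ℝ :=
  zeroWindow cHat₁ α T t

/-- **`C_{2,α}(t) = −α⁻¹ + Σ_γ (sin(½α(γ−t) log T)/(½α(γ−t) log T))² (1 − (α(t−γ) log T/2π)²)⁻¹`**
(summand `Ĉ₂(v)`, `Ĉ₂` even). [cite: Aryan2019, §2 (Definition of C_{2,α})] -/
def windowC₂ (α T t : ℝ) : ℝ :=
  zeroWindow cHat₂ α T t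

/-! ### Dirichlet polynomials on the critical line, the weight `ω_T`, the measure `μ_A` -/

/-- `A(½ + it) = Σ_{1 ≤ n ≤ N} a(n) n^{−(½+it)}` for real coefficients `a` and length `N`.
[cite: Aryan2019, §2 (def_A)] -/
def critLinePoly (a : ℕ → ℝ) (N : ℕ) (t : ℝ) : ℂ :=
  ∑ n ∈ Finset.Icc 1 N, (a n : ℂ) * (n : ℂ) ^ (-(1 / 2 + (t : ℂ) * I))

/-- A **smooth bump**: `w ∈ C^∞(ℝ)`, `w ≥ 0`, supported in `[1, 2]`, `∫ w = 1` — the fixed profile of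
the cut-off weight. [cite: Aryan2019, §2 ("ω a cut-off weight, centered around T, with ‖ω‖₁ = 1")] -/
def IsBump (w : ℝ → ℝ) : Prop :=
  ContDiff ℝ (⊤ : ℕ∞) w ∧ (∀ t, 0 ≤ w t) ∧ Function.support w ⊆ Set.Icc 1 2 ∧ ∫ t, w t = 1

/-- The **cut-off weight centred around `T`**: `ω_T(t) = T⁻¹ w(t/T)` (so `‖ω_T‖₁ = ‖w‖₁ = 1` for
`T > 0`, `integral_scaledWeight`). [cite: Aryan2019, §2 (def_A)] -/
def scaledWeight (w : ℝ → ℝ) (T t : ℝ) : ℝ :=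
  w (t / T) / T

/-- `‖ω_T‖₁ = ∫ w` for `T > 0` (substitution `t = T u`). [cite: Aryan2019, §2 ("‖ω‖₁ = 1")] -/
theorem integral_scaledWeight (w : ℝ → ℝ) {T : ℝ} (hT : 0 < T) :
    ∫ t, scaledWeight w T t = ∫ u, w u := by
  unfold scaledWeight
  rw [integral_div, Measure.integral_comp_div (fun u ↦ w u) T, smul_eq_mul, abs_of_pos hT,
    mul_div_cancel_left₀ _ hT.ne']

/-- **`E_{C,A} = ∫ C dμ_A = (∫ C(t) ω_T(t)|A(½+it)|² dt)/(∫ ω_T(t)|A(½+it)|² dt)`** (eq2)/(def_A).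
Junk `0` when `A ≡ 0`. [cite: Aryan2019, §2 (def_A)] -/
def expectation (C : ℝ → ℝ) (w : ℝ → ℝ) (a : ℕ → ℝ) (N : ℕ) (T : ℝ) : ℝ :=
  (∫ t, C t * (scaledWeight w T t * ‖critLinePoly a N t‖ ^ 2)) /
    ∫ t, scaledWeight w T t * ‖critLinePoly a N t‖ ^ 2

/-- With no coefficients (`N = 0`) the polynomial vanishes and `E_{C,A}` is the junk value `0`.
[cite: Aryan2019, §2 (def_A)] -/
theorem expectation_length_zero (C : ℝ → ℝ) (w : ℝ → ℝ) (a : ℕ → ℝ) (T : ℝ) :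
    expectation C w a 0 T = 0 := by
  simp [expectation, critLinePoly]

end Aryan2019

open Aryan2019

/-- **Aryan 2019, Theorem 5.1** (CLAIM of an unrefereed preprint; RH per the source's Remark 3). For
every smooth bump `w` (weight `ω_T = T⁻¹w(·/T)`), every `ε > 0` and every family of real Dirichlet
polynomials `A_T(s) = Σ_{n ≤ N_T} a_T(n) n^{−s}` of length `N_T < T^{1−ε}`: for all sufficiently large
`T`, `E_{C_{1,1},A_T} = ∫ C_{1,1} dμ_{A_T} < 0.79371` and `E_{C_{2,1},A_T} = ∫ C_{2,1} dμ_{A_T} < 0.90156`.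
("The theorem basically says that `C_{1,1}` is expected to be smaller than `0.79371`, for any
probability measure that we make using Dirichlet polynomials of length smaller than `T^{1−ε}`"; to
reject AH one would need `> 1`, §4.1.) Status: claim-in-preprint, not proved here.
[claim: Aryan2019, status: under-review] -/
def aryan2019_theorem51 : Prop :=
  RiemannHypothesis → ∀ w : ℝ → ℝ, IsBump w → ∀ ε : ℝ, 0 < ε →
    ∀ (N : ℝ → ℕ) (a : ℝ → ℕ → ℝ), (∀ᶠ T : ℝ in atTop, (N T : ℝ) < T ^ (1 - ε)) →
      ∀ᶠ T : ℝ in atTop,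
        expectation (windowC₁ 1 T) w (a T) (N T) T < 0.79371 ∧
          expectation (windowC₂ 1 T) w (a T) (N T) T < 0.90156

/-- **Aryan 2019, Corollary 2.2** (CLAIM of an unrefereed preprint). "Assume the Riemann hypothesis,
then either we have infinitely many zeta zeros of height asymptotic to `T`, that spaced smaller than
the half of the average gap, i.e. `γ_{n+1} − γ_n < π/log T`, or we have
`γ_{n+2} − γ_n < 1.181·2π/log T`" — rendered: RH ⇒ (`μ ≤ ½` for the normalised gaps, the tree's
`ZetaGapLiminfLe (1/2)`) ∨ (for every `θ > 1.181`, infinitely many `n` with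
`(γ_{n+2} − γ_n) log γ_n/2π ≤ θ`). Compare Conrey–Turnage-Butterbaugh 2018: `γ_{n+2} − γ_n <
1.576·2π/log T` infinitely often, unconditionally in the second branch's shape (Remark 2). Status:
claim-in-preprint, not proved here. [claim: Aryan2019, status: under-review] -/
def aryan2019_corollary22 : Prop :=
  RiemannHypothesis →
    ZetaGapLiminfLe (1 / 2) ∨
      ∀ θ : ℝ, 1.181 < θ → ∃ᶠ n : ℕ in atTop,
        (zetaOrdinate (n + 2) - zetaOrdinate n) * (Real.log (zetaOrdinate n) / (2 * π)) ≤ θ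

end Literature.NumberTheory.LFunctions

end
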